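import Summits.BirchSwinnertonDyer.Rank1Residual.Supersingular.GoodThreeKimTamagawaDefectOPEN
import Summits.BirchSwinnertonDyer.Rank1Residual.Additive.X4KimLargeImageLevelKRankOne
import Literature.NumberTheory.EllipticCurves.Rank1Residual.Typed.CasselsLowerBound
import HarnessLib

/-!
# Analytic rank ONE under the `p`-adic tower, `p ≥ 3` (class O3 = X8 ∧ `r = 1` at `p = 3`; O4@3): the
# LEVEL-`p^k` Kurihara-number reading `ord_p #Ш(E/ℚ)(p) ≤ k − 1` with NO Manin and NO period binder,
# `#Ш(E/ℚ)(p) = 1` from a level `k ≤ 2` by Cassels–Tate squareness, and `BSD(E,p)` on the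
# `ord_p #Ш_an = 2j` rows from ONE Kurihara number of level `k ≤ 2j + 2` plus the descent bit
# `p^{2j−1} ∣ #Ш` — CONDITIONAL on the announced Kim 2025 (arXiv:2505.09121, PREPRINT) structure clause
# (cell `b2b-bsdres`, supersingular family, prover B = unit `b2b-bsdres-additive-p3`, gen 18; CLASS-CLOSURE
# §3.12 O3 = X8 ∧ `r = 1`, class lead additive-p3; X7 joint pair, B side, for O4@3)

HONEST FRAMING (run/shared/lean/b2b/bsd-rank1-residual/, verbatim in every file): the goal of the
cell is to DELETE the COMBINATION-SHAPED residual classes of the Birch–Swinnerton-Dyer formula for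
ALL analytic-rank `≤ 1` elliptic curves over `ℚ` — "full BSD formula for every rank `≤ 1` curve in
class `C`" assembled STRICTLY from published theorems — so that the rank-`≤ 1` remainder becomes
exactly the CONSTRUCTION-SHAPED classes, which are TYPED (missing-input `Prop`s), NOT attempted.
This is not "finishing BSD". Research route; no claim beyond the stated classes. X8 / X7 / X6 stay
CONSTRUCTION-SHAPED; per pair only; nothing about any curve is asserted; nothing is booked; no mark
of RESIDUAL-MAP §I (O3 / O4) moves. An ANNOUNCED preprint enters ONLY as an explicitly labelled OPEN
hypothesis: every theorem below carrying `hK25s : Kim2025.thm11_kimShaLength_of_integralPeriod_OPEN`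
is CONDITIONAL on the unrefereed arXiv:2505.09121v1 (C.-H. Kim, appendix with R. Pollack, 2025;
Thm. 1.1 ("BSD") second clause, typed by n1011-p09 in `Kim2025/StructureClauseOPEN.lean`; its `p = 3`
Kolyvagin-system input, Sakamoto, JTNB 36 (2024), IS refereed). Theorems only (compositions of tree
theorems BY NAME); no definition, no named fact (debt 0).

## What is proved

In analytic rank ONE Kim 2025 Thm. 1.1 second clause reads `length Ш(E/ℚ)[p^∞] = ∂^{(1)}(δ̃) − ∂^{(∞)}(δ̃)`
(`L(E,1) = 0 ⇒ δ̃_1 = 0`; a non-zero prime-level Kurihara number makes `ord(δ̃) = 1`); n1011-p11's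
OWN-CURRENCY theorem `Additive.rankOne_sha_val_le_of_thm11_of_levelK` (T-a4-LK, p254794) turns ONE
Kurihara number non-zero modulo `p^k` at a CYCLIC Kolyvagin prime `ℓ ∈ 𝒫_k` (`ℓ ∤ Np`, `ℓ ≡ 1`,
`a_ℓ ≡ ℓ + 1 (mod p^k)`, `#Ẽ(𝔽_ℓ)[p] ≤ p`) into `ord_p #Ш(E/ℚ)(p) ≤ k − 1`, under the binders: `p ≥ 3`,
the tower `∀ n, ρ̄_{E,p^n}` onto, `L(E,1) = 0`, `Ш` finite, the newform `f`, and the `Ω⁺_f`-integrality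
of every plus symbol. This file DISCHARGES the last three on the cell's rows — `L(E,1) = 0` from
`r_an = 1` (modularity `hmod`), `Ш` finite from Gross–Zagier–Kolyvagin (`hGZK`), integrality from the
tower by n1011-p09's `forall_padicValRat_ratPlusSymbol_nonneg_of_towerSurj` (Drinfeld–Manin) — so that
NO Manin constant and NO period transfer enter (compare gen 17's `X8KimLargeImageRankOneOPEN.lean`,
unit level only, with both binders), and adds the two PUBLISHED closing steps:

* §1 (any `p ≥ 3`, any reduction at `p`, tower): `RankOne.padicValNat_sha_le_of_kim2025_OPEN_of_kuriharaNumber_ne_zero`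
  (`ord_p #Ш(p) ≤ k − 1`); with Cassels–Tate squareness (`hCT`, Silverman X.4.14, PUBLISHED named fact)
  a level `k ≤ 2` gives `#Ш(E/ℚ)(p) = 1` (`…card_sha_eq_one_…_of_le_two`) and hence `BSD(E,p) ⟺
  ord_p #Ш_an = 0` / `BSD(E,p)` on the `#Ш_an` `p`-unit rows; and on the rows with `ord_p #Ш_an = 2j`
  ONE Kurihara number of level `k ≤ 2j + 2` together with the descent bit `p^{2j−1} ∣ #Ш(E/ℚ)` gives
  `BSD(E,p)` (`…bsdp_of_…_of_pow_dvd`: squareness pins `ord_p #Ш = 2j`). The level-`k` certificate is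
  what Kim's Conjecture 1.10 predicts to exist first at `k = ord_p #Ш + ord_p ∏ c_ℓ + 1`; its EXISTENCE
  is an instrument output per pair (CLASS-CLOSURE B-4, cc-eng-6 KURX), never a theorem here.
* §2 O3 = X8 ∧ `r_an = 1` at `p = 3` with the tower FED (surj(3) + one Frobenius mod `9`, gen 16
  p250381; semistable + modularity + Ribet–Diamond, p249601) and O4@3 = X7@3 ∧ `r_an = 1` (surj(3) +
  Frobenius). Census pointers (obsanat `class-closure/O3/pairs.tsv` b7f2e4b939228f9a): O3 = 819 cells,
  of which 20 surj ∧ `3 ∤ ∏c` ∧ `ord₃ #Ш_an = 2` (the `j = 1` shape: level `k ≤ 4` + `3 ∣ #Ш`), 1 surj ∧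
  `3 ∤ ∏c·#Ш_an` (`k ≤ 2`), 792 surj ∧ `3 ∣ ∏c` ∧ `ord₃ #Ш_an = 0` (`k ≤ 2` closes; Conjecture 1.10
  predicts the first non-zero number at `k = ord₃ ∏c + 1 ≥ 3`, so on those rows the shape is EMPTY in
  expectation and the lane's exact `3`-descent (`#Sel₃ = 3`, F3BW) remains the lever), 6 `3Nn` (no tower).

NOT claimed: no class theorem; nothing about the `≥` half of Conjecture 1.10 in rank one (no published
upper bound at a supersingular `3` with `a_3 ≠ 0`: Wuthrich's Prop. 21 is a rank-`0` statement); no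
certificate is asserted to exist.

References: [Kim2025RefinedTNC] Thm. 1.1 ("BSD") (ANNOUNCED, OPEN binder); [Sakamoto2024KolyvaginThree]
Thm. 1.1; [Kim2022StructureSelmer] Thm. 1.9 (6), §1.5.1, Conj. 1.10; [SilvermanAEC2009] Thm. X.4.14
(Cassels–Tate); [SerreAbelianLadic1968] IV §3.4; [Ribet1990]; [Diamond1995RefinedSerre]; [Miller2011LMS]
Def. 1.1; HOME class-closure/O3/STATEMENT.md.
-/

noncomputable section

open scoped Classical MatrixGroups ModularForm

open CongruenceSubgroup WeierstrassCurve Literature.NumberTheory.EllipticCurves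
  Literature.NumberTheory.EllipticCurves.ModularForms
  Literature.NumberTheory.EllipticCurves.Rank1Residual
  Literature.NumberTheory.EllipticCurves.Rank1Residual.Typed
  Summit.BirchSwinnertonDyer.Rank1Residual.Additive

namespace Summit.BirchSwinnertonDyer.Rank1Residual.Supersingular

variable (W : WeierstrassCurve ℚ) [W.IsElliptic] [W.IsGloballyMinimal] (p : ℕ) [hp : Fact p.Prime]

/-! ### §1 Analytic rank one under the tower, any `p ≥ 3`, any reduction at `p` -/

/-- **`ord_p #Ш(E/ℚ)(p) ≤ k − 1` from ONE level-`p^k` prime certificate, NO Manin / period binder**: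
`p ≥ 3`, the tower `∀ n, ρ̄_{E,p^n}` onto, `r_an = 1`, a parametrisation datum `D` (only its newform
`D.f` is used), a cyclic Kolyvagin prime `ℓ ∈ 𝒫_k(E,p)` (`1 ≤ k`), a surjective `ψ_ℓ : (ℤ/ℓ)ˣ ↠ ℤ/p^k`
and `kuriharaNumber D.f (p^k) ℓ ψ ≠ 0` ⟹ `ord_p #Ш(E/ℚ)(p) ≤ k − 1`. n1011-p11's own-currency
`rankOne_sha_val_le_of_thm11_of_levelK` with `L(E,1) = 0` from `hmod`, `Ш` finite from `hGZK`, and the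
`Ω⁺_f`-integrality from the tower (`forall_padicValRat_ratPlusSymbol_nonneg_of_towerSurj`). CONDITIONAL
on `hK25s` (OPEN). Per pair. [claim: Kim2025RefinedTNC, status: under-review]
[cite: Kim2025RefinedTNC, Thm. 1.1 ("BSD") (ANNOUNCED, OPEN binder)] [cite: Kim2022StructureSelmer, Thm. 1.9 (6), §1.5.1 (PDF pp. 7–8)] -/
theorem RankOne.padicValNat_sha_le_of_kim2025_OPEN_of_kuriharaNumber_ne_zero
    (hK25s : Kim2025.thm11_kimShaLength_of_integralPeriod_OPEN)
    (hGZK : rank_eq_analyticRank_of_analyticRank_le_one) (hmod : hasEntireLFunction_rat)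
    (hp3 : 3 ≤ p) (hr : W.analyticRank = 1) (htower : ∀ n : ℕ, W.HasSurjectiveModNGaloisRep (p ^ n : ℕ))
    {N : ℕ} [NeZero N] (D : ModularParametrizationData W N)
    {k : ℕ} (hk : 1 ≤ k) (ℓ : ℕ) [Fact ℓ.Prime] (hℓ : Kato.IsKolyvaginPrime W p k ℓ)
    (hcyc : Nat.card {P : ((WeierstrassCurve.integralModelInt W).map
        (Int.castRingHom (ZMod ℓ))).toAffine.Point // p • P = 0} ≤ p)
    (ψ : (ℓ' : ℕ) → (ZMod ℓ')ˣ →* Multiplicative (ZMod (p ^ k)))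
    (hψ : Function.Surjective (ψ ℓ)) (hδ : kuriharaNumber D.f (p ^ k) ℓ ψ ≠ 0) :
    padicValNat p (Nat.card (AddCommGroup.primaryComponent W.sha p)) ≤ k - 1 := by
  have hp2 : p ≠ 2 := by omega
  have hL : W.entireLFunction 1 = 0 := by
    by_contra hL
    have h0 := (W.analyticRank_eq_zero_iff_holds (hmod W)).mpr hL
    omega
  have hfin : Finite W.sha := (hGZK W (by rw [hr])).2
  exact rankOne_sha_val_le_of_thm11_of_levelK W p hK25s hp3 htower hL hfin D.isNewformOf
    (forall_padicValRat_ratPlusSymbol_nonneg_of_towerSurj hp2 D.isNewformOf htower) hk ℓ hℓ hcyc ψ hψ hδ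

/-- The `p`-adic valuation of a non-zero perfect square is even. [folklore] -/
private theorem even_padicValNat_of_isSquare {n : ℕ} (hsq : IsSquare n) (hn : n ≠ 0) :
    Even (padicValNat p n) := by
  obtain ⟨m, rfl⟩ := hsq
  have hm : m ≠ 0 := fun h => hn (by rw [h, mul_zero])
  rw [padicValNat.mul hm hm]
  exact ⟨_, rfl⟩

omit [W.IsGloballyMinimal] in
/-- **Cassels–Tate squareness pins an even valuation between a LOWER certificate and an UPPER one.**
`Ш(E/ℚ)` finite, `#Ш` a square (`hCT`, Silverman X.4.14), `p^{2j−1} ∣ #Ш` and `ord_p #Ш(p) ≤ 2j + 1`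
⟹ `ord_p #Ш(E/ℚ) = 2j`. Fact-free apart from `hCT`. [cite: SilvermanAEC2009, Thm. X.4.14] -/
theorem padicValNat_shaOrder_eq_of_casselsTate_of_pow_dvd_of_le
    (hCT : exists_casselsTate_pairing (K := ℚ)) (hfin : Finite W.sha) {j : ℕ}
    (hdvd : p ^ (2 * j - 1) ∣ W.shaOrder)
    (hle : padicValNat p (Nat.card (AddCommGroup.primaryComponent W.sha p)) ≤ 2 * j + 1) :
    padicValNat p W.shaOrder = 2 * j := by
  haveI : Finite W.sha := hfin
  have hsq : IsSquare W.shaOrder := isSquare_shaOrder_of_casselsTate hCT W hfin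
  have hn : W.shaOrder ≠ 0 := (WeierstrassCurve.shaOrder_pos W hfin).ne'
  have hlow : 2 * j ≤ padicValNat p W.shaOrder := two_mul_le_padicValNat_of_isSquare_of_pow_dvd hsq hn hdvd
  have hcard : padicValNat p (Nat.card (AddCommGroup.primaryComponent W.sha p)) =
      padicValNat p W.shaOrder := by
    unfold WeierstrassCurve.shaOrder
    exact padicValNat_card_addPrimaryComponent p
  rw [hcard] at hle
  obtain ⟨m, hm⟩ := even_padicValNat_of_isSquare p hsq hn
  omega

/-- **`#Ш(E/ℚ)(p) = 1` in analytic rank one from ONE Kurihara number of level `k ≤ 2`** (`p ≥ 3`, tower):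
the certificate gives `ord_p #Ш(p) ≤ 1` (§1), Cassels–Tate squareness (`hCT`, PUBLISHED) makes it `0`.
`k = 1` is the unit case (gen 17 / Kim 2025 rank-one unit clause); `k = 2` the level-two clause (Kim AJM
148's `p ≥ 5` published shape, here at any `p ≥ 3` modulo the preprint). CONDITIONAL on `hK25s` (OPEN).
Per pair. [claim: Kim2025RefinedTNC, status: under-review] [cite: Kim2025RefinedTNC, Thm. 1.1 (ANNOUNCED, OPEN binder)]
[cite: SilvermanAEC2009, Thm. X.4.14] [cite: Kim2022StructureSelmer, Thm. 1.9 (6) (PDF p. 8)] -/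
theorem RankOne.card_sha_eq_one_of_kim2025_OPEN_of_casselsTate_of_kuriharaNumber_ne_zero_of_le_two
    (hK25s : Kim2025.thm11_kimShaLength_of_integralPeriod_OPEN)
    (hCT : exists_casselsTate_pairing (K := ℚ))
    (hGZK : rank_eq_analyticRank_of_analyticRank_le_one) (hmod : hasEntireLFunction_rat)
    (hp3 : 3 ≤ p) (hr : W.analyticRank = 1) (htower : ∀ n : ℕ, W.HasSurjectiveModNGaloisRep (p ^ n : ℕ))
    {N : ℕ} [NeZero N] (D : ModularParametrizationData W N)
    {k : ℕ} (hk : 1 ≤ k) (hk2 : k ≤ 2) (ℓ : ℕ) [Fact ℓ.Prime] (hℓ : Kato.IsKolyvaginPrime W p k ℓ)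
    (hcyc : Nat.card {P : ((WeierstrassCurve.integralModelInt W).map
        (Int.castRingHom (ZMod ℓ))).toAffine.Point // p • P = 0} ≤ p)
    (ψ : (ℓ' : ℕ) → (ZMod ℓ')ˣ →* Multiplicative (ZMod (p ^ k)))
    (hψ : Function.Surjective (ψ ℓ)) (hδ : kuriharaNumber D.f (p ^ k) ℓ ψ ≠ 0) :
    Nat.card (AddCommGroup.primaryComponent W.sha p) = 1 := by
  have hfin : Finite W.sha := (hGZK W (by rw [hr])).2
  haveI : Finite W.sha := hfin
  have hle := RankOne.padicValNat_sha_le_of_kim2025_OPEN_of_kuriharaNumber_ne_zero W p hK25s hGZK hmod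
    hp3 hr htower D hk ℓ hℓ hcyc ψ hψ hδ
  have h0 : padicValNat p W.shaOrder = 2 * 0 :=
    padicValNat_shaOrder_eq_of_casselsTate_of_pow_dvd_of_le W p hCT hfin (j := 0) (by simp) (by omega)
  have hcard : padicValNat p (Nat.card (AddCommGroup.primaryComponent W.sha p)) =
      padicValNat p W.shaOrder := by
    unfold WeierstrassCurve.shaOrder
    exact padicValNat_card_addPrimaryComponent p
  exact card_primaryComponent_eq_one_of_padicValNat_eq_zero W p (by rw [hcard, h0])

/-- **`BSD(E,p) ⟺ ord_p #Ш_an = 0` in analytic rank one, given ONE Kurihara number of level `k ≤ 2`**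
(`p ≥ 3`, tower; `#Ш_an = q ∈ ℚ` the per-pair value): from `#Ш(E/ℚ)(p) = 1` and additive-p3's
`X4.bsdp_iff_padicValRat_eq_zero_of_card_primaryComponent_eq_one`. CONDITIONAL on `hK25s` (OPEN); `hCT`,
`hGZK`, `hmod` PUBLISHED. Per pair. [claim: Kim2025RefinedTNC, status: under-review]
[cite: Kim2025RefinedTNC, Thm. 1.1 (ANNOUNCED, OPEN binder)] [cite: SilvermanAEC2009, Thm. X.4.14] [cite: Miller2011LMS, Def. 1.1] -/
theorem RankOne.bsdp_iff_padicValRat_eq_zero_of_kim2025_OPEN_of_casselsTate_of_kuriharaNumber_ne_zero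
    (hK25s : Kim2025.thm11_kimShaLength_of_integralPeriod_OPEN)
    (hCT : exists_casselsTate_pairing (K := ℚ))
    (hGZK : rank_eq_analyticRank_of_analyticRank_le_one) (hmod : hasEntireLFunction_rat)
    (hp3 : 3 ≤ p) (hr : W.analyticRank = 1) (htower : ∀ n : ℕ, W.HasSurjectiveModNGaloisRep (p ^ n : ℕ))
    {N : ℕ} [NeZero N] (D : ModularParametrizationData W N)
    {k : ℕ} (hk : 1 ≤ k) (hk2 : k ≤ 2) (ℓ : ℕ) [Fact ℓ.Prime] (hℓ : Kato.IsKolyvaginPrime W p k ℓ)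
    (hcyc : Nat.card {P : ((WeierstrassCurve.integralModelInt W).map
        (Int.castRingHom (ZMod ℓ))).toAffine.Point // p • P = 0} ≤ p)
    (ψ : (ℓ' : ℕ) → (ZMod ℓ')ˣ →* Multiplicative (ZMod (p ^ k)))
    (hψ : Function.Surjective (ψ ℓ)) (hδ : kuriharaNumber D.f (p ^ k) ℓ ψ ≠ 0)
    {q : ℚ} (hq : shaAn W = (q : ℂ)) : BSDp W p ↔ padicValRat p q = 0 := by
  obtain ⟨hmw, hfin⟩ := hGZK W (by rw [hr])
  exact X4.bsdp_iff_padicValRat_eq_zero_of_card_primaryComponent_eq_one W p hmw hfin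
    (RankOne.card_sha_eq_one_of_kim2025_OPEN_of_casselsTate_of_kuriharaNumber_ne_zero_of_le_two W p hK25s
      hCT hGZK hmod hp3 hr htower D hk hk2 ℓ hℓ hcyc ψ hψ hδ) hq

/-- **`BSD(E,p)` in analytic rank one on an `ord_p #Ш_an = 2j` row from ONE Kurihara number of level
`k ≤ 2j + 2` and the descent bit `p^{2j−1} ∣ #Ш(E/ℚ)`** (`p ≥ 3`, tower): the Kurihara number gives
`ord_p #Ш(p) ≤ k − 1 ≤ 2j + 1` (§1, `hK25s` OPEN), the divisibility and Cassels–Tate squareness (`hCT`)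
give `ord_p #Ш = 2j = ord_p #Ш_an`, i.e. Miller's `BSD(E,p)` (GZK `hGZK`). `j = 0`: the `#Ш_an`-unit rows,
no descent bit (`p^0 ∣ #Ш` trivially is NOT what is asked: `2·0 − 1 = 0` in `ℕ`, so `hdvd` reads
`1 ∣ #Ш`), level `k ≤ 2`; `j = 1`: O3's 20 surj ∧ `3 ∤ ∏c` ∧ `#Ш_an = 9·unit` cells — level `k ≤ 4` plus
`3 ∣ #Ш` (exact `3`-descent `dim Sel₃ = 3`). Per pair; NOT a class theorem; no certificate asserted.
[claim: Kim2025RefinedTNC, status: under-review] [cite: Kim2025RefinedTNC, Thm. 1.1 (ANNOUNCED, OPEN binder)]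
[cite: SilvermanAEC2009, Thm. X.4.14] [cite: Miller2011LMS, §1 and Def. 1.1] -/
theorem RankOne.bsdp_of_kim2025_OPEN_of_casselsTate_of_kuriharaNumber_ne_zero_of_pow_dvd
    (hK25s : Kim2025.thm11_kimShaLength_of_integralPeriod_OPEN)
    (hCT : exists_casselsTate_pairing (K := ℚ))
    (hGZK : rank_eq_analyticRank_of_analyticRank_le_one) (hmod : hasEntireLFunction_rat)
    (hp3 : 3 ≤ p) (hr : W.analyticRank = 1) (htower : ∀ n : ℕ, W.HasSurjectiveModNGaloisRep (p ^ n : ℕ))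
    {N : ℕ} [NeZero N] (D : ModularParametrizationData W N)
    {j k : ℕ} (hk : 1 ≤ k) (hkj : k ≤ 2 * j + 2) (ℓ : ℕ) [Fact ℓ.Prime] (hℓ : Kato.IsKolyvaginPrime W p k ℓ)
    (hcyc : Nat.card {P : ((WeierstrassCurve.integralModelInt W).map
        (Int.castRingHom (ZMod ℓ))).toAffine.Point // p • P = 0} ≤ p)
    (ψ : (ℓ' : ℕ) → (ZMod ℓ')ˣ →* Multiplicative (ZMod (p ^ k)))
    (hψ : Function.Surjective (ψ ℓ)) (hδ : kuriharaNumber D.f (p ^ k) ℓ ψ ≠ 0)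
    (hdvd : p ^ (2 * j - 1) ∣ W.shaOrder)
    {q : ℚ} (hq : shaAn W = (q : ℂ)) (hv : padicValRat p q = 2 * j) : BSDp W p := by
  have hfin : Finite W.sha := (hGZK W (by rw [hr])).2
  have hle := RankOne.padicValNat_sha_le_of_kim2025_OPEN_of_kuriharaNumber_ne_zero W p hK25s hGZK hmod
    hp3 hr htower D hk ℓ hℓ hcyc ψ hψ hδ
  have heq : padicValNat p W.shaOrder = 2 * j :=
    padicValNat_shaOrder_eq_of_casselsTate_of_pow_dvd_of_le W p hCT hfin hdvd (by omega)
  refine bsdp_of_missingPPartAt W p hGZK (by rw [hr]) ⟨q, hq, ?_⟩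
  rw [hv, heq]; push_cast; ring

/-! ### §2 O3 = X8 ∧ `r_an = 1` at `p = 3`, and O4@3 = X7@3 ∧ `r_an = 1`, with the tower FED -/

/-- **O3, tower from surj(3) + ONE Frobenius mod `9`: `BSD(E,3) ⟺ ord₃ #Ш_an = 0` from ONE Kurihara
number of level `k ≤ 2` at a cyclic Kolyvagin prime** (X8 ∧ `r_an = 1`; lit-kato's certificate `ℓ' ≡ 2,5
(9)`, `a_{ℓ'} ≡ 3,6 (9)`), CONDITIONAL on `hK25s` (OPEN); `hCT`, `hGZK`, `hmod` PUBLISHED; NO Manin /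
period binder. Per pair; NOT a class theorem. [claim: Kim2025RefinedTNC, status: under-review]
[cite: Kim2025RefinedTNC, Thm. 1.1 (ANNOUNCED, OPEN binder)] [cite: SilvermanAEC2009, Thm. X.4.14]
[cite: SerreAbelianLadic1968, Ch. IV §3.4, Lemma 3 (IV-23)] [cite: Miller2011LMS, Def. 1.1] -/
theorem X8RankOne.bsdp_iff_padicValRat_eq_zero_of_kim2025_OPEN_of_kuriharaNumber_ne_zero_of_frobenius
    (hK25s : Kim2025.thm11_kimShaLength_of_integralPeriod_OPEN)
    (hCT : exists_casselsTate_pairing (K := ℚ))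
    (hGZK : rank_eq_analyticRank_of_analyticRank_le_one) (hmod : hasEntireLFunction_rat)
    (hr : W.analyticRank = 1) (hX : ClassX8 W 3) (hs : Surj W 3)
    (ℓ' : ℕ) [Fact ℓ'.Prime] (hgood : W.HasGoodReductionAtPrime ℓ')
    (hℓ9 : ℓ' % 9 = 2 ∨ ℓ' % 9 = 5) (ha9 : W.frobeniusTrace ℓ' % 9 = 3 ∨ W.frobeniusTrace ℓ' % 9 = 6)
    {N : ℕ} [NeZero N] (D : ModularParametrizationData W N)
    {k : ℕ} (hk : 1 ≤ k) (hk2 : k ≤ 2) (ℓ : ℕ) [Fact ℓ.Prime] (hℓ : Kato.IsKolyvaginPrime W 3 k ℓ)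
    (hcyc : Nat.card {P : ((WeierstrassCurve.integralModelInt W).map
        (Int.castRingHom (ZMod ℓ))).toAffine.Point // 3 • P = 0} ≤ 3)
    (ψ : (ℓ'' : ℕ) → (ZMod ℓ'')ˣ →* Multiplicative (ZMod (3 ^ k)))
    (hψ : Function.Surjective (ψ ℓ)) (hδ : kuriharaNumber D.f (3 ^ k) ℓ ψ ≠ 0)
    {q : ℚ} (hq : shaAn W = (q : ℂ)) : BSDp W 3 ↔ padicValRat 3 q = 0 :=
  RankOne.bsdp_iff_padicValRat_eq_zero_of_kim2025_OPEN_of_casselsTate_of_kuriharaNumber_ne_zero W 3 hK25s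
    hCT hGZK hmod le_rfl hr (towerSurj_of_frobenius_of_eq_three W 3 hX.1 hs ℓ' hgood hℓ9 ha9) D hk hk2 ℓ hℓ
    hcyc ψ hψ hδ hq

/-- **O3's `#Ш_an = 9·unit` rows (20 window+beyond cells, surj ∧ `3 ∤ ∏c`), tower from surj(3) + ONE
Frobenius mod `9`: `BSD(E,3)` from ONE Kurihara number of level `k ≤ 4` at a cyclic Kolyvagin prime PLUS
the descent bit `3 ∣ #Ш(E/ℚ)`** (X8 ∧ `r_an = 1`, `ord₃ #Ш_an = 2`), CONDITIONAL on `hK25s` (OPEN); `hCT`,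
`hGZK`, `hmod` PUBLISHED. Per pair; NOT a class theorem. [claim: Kim2025RefinedTNC, status: under-review]
[cite: Kim2025RefinedTNC, Thm. 1.1 (ANNOUNCED, OPEN binder)] [cite: SilvermanAEC2009, Thm. X.4.14]
[cite: SerreAbelianLadic1968, Ch. IV §3.4, Lemma 3 (IV-23)] [cite: Miller2011LMS, §1 and Def. 1.1] -/
theorem X8RankOne.bsdp_three_of_kim2025_OPEN_of_kuriharaNumber_ne_zero_of_three_dvd_of_frobenius
    (hK25s : Kim2025.thm11_kimShaLength_of_integralPeriod_OPEN)
    (hCT : exists_casselsTate_pairing (K := ℚ))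
    (hGZK : rank_eq_analyticRank_of_analyticRank_le_one) (hmod : hasEntireLFunction_rat)
    (hr : W.analyticRank = 1) (hX : ClassX8 W 3) (hs : Surj W 3)
    (ℓ' : ℕ) [Fact ℓ'.Prime] (hgood : W.HasGoodReductionAtPrime ℓ')
    (hℓ9 : ℓ' % 9 = 2 ∨ ℓ' % 9 = 5) (ha9 : W.frobeniusTrace ℓ' % 9 = 3 ∨ W.frobeniusTrace ℓ' % 9 = 6)
    {N : ℕ} [NeZero N] (D : ModularParametrizationData W N)
    {k : ℕ} (hk : 1 ≤ k) (hk4 : k ≤ 4) (ℓ : ℕ) [Fact ℓ.Prime] (hℓ : Kato.IsKolyvaginPrime W 3 k ℓ)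
    (hcyc : Nat.card {P : ((WeierstrassCurve.integralModelInt W).map
        (Int.castRingHom (ZMod ℓ))).toAffine.Point // 3 • P = 0} ≤ 3)
    (ψ : (ℓ'' : ℕ) → (ZMod ℓ'')ˣ →* Multiplicative (ZMod (3 ^ k)))
    (hψ : Function.Surjective (ψ ℓ)) (hδ : kuriharaNumber D.f (3 ^ k) ℓ ψ ≠ 0)
    (hdvd : 3 ∣ W.shaOrder) {q : ℚ} (hq : shaAn W = (q : ℂ)) (hv : padicValRat 3 q = 2) : BSDp W 3 :=
  RankOne.bsdp_of_kim2025_OPEN_of_casselsTate_of_kuriharaNumber_ne_zero_of_pow_dvd W 3 hK25s hCT hGZK hmod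
    le_rfl hr (towerSurj_of_frobenius_of_eq_three W 3 hX.1 hs ℓ' hgood hℓ9 ha9) D (j := 1) hk (by omega) ℓ
    hℓ hcyc ψ hψ hδ (by simpa using hdvd) hq (by rw [hv]; norm_num)

/-- **O3 ∩ {sst}, tower from modularity + Ribet–Diamond (NO image certificate): `BSD(E,3) ⟺ ord₃ #Ш_an
= 0` from ONE Kurihara number of level `k ≤ 2`** (X8 ∧ sst ∧ `r_an = 1`), CONDITIONAL on `hK25s` (OPEN).
Per pair. [claim: Kim2025RefinedTNC, status: under-review] [cite: Kim2025RefinedTNC, Thm. 1.1 (ANNOUNCED, OPEN binder)]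
[cite: SilvermanAEC2009, Thm. X.4.14] [cite: Ribet1990, Thm. 1.1] [cite: Diamond1995RefinedSerre, Thm. 1.1]
[cite: Serre1972, §5.4 Prop. 21 i)] [cite: Miller2011LMS, Def. 1.1] -/
theorem X8RankOne.bsdp_iff_padicValRat_eq_zero_of_kim2025_OPEN_of_kuriharaNumber_ne_zero_of_semistable
    (hK25s : Kim2025.thm11_kimShaLength_of_integralPeriod_OPEN)
    (hCT : exists_casselsTate_pairing (K := ℚ))
    (hGZK : rank_eq_analyticRank_of_analyticRank_le_one) (hmod : hasEntireLFunction_rat)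
    (hmod' : exists_isNewformOf) (hLL : Literature.NumberTheory.Automorphic.diamond1995_refinedSerre)
    (hr : W.analyticRank = 1) (hX : ClassX8 W 3) (hsst : Semistable W)
    {N : ℕ} [NeZero N] (D : ModularParametrizationData W N)
    {k : ℕ} (hk : 1 ≤ k) (hk2 : k ≤ 2) (ℓ : ℕ) [Fact ℓ.Prime] (hℓ : Kato.IsKolyvaginPrime W 3 k ℓ)
    (hcyc : Nat.card {P : ((WeierstrassCurve.integralModelInt W).map
        (Int.castRingHom (ZMod ℓ))).toAffine.Point // 3 • P = 0} ≤ 3)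
    (ψ : (ℓ'' : ℕ) → (ZMod ℓ'')ˣ →* Multiplicative (ZMod (3 ^ k)))
    (hψ : Function.Surjective (ψ ℓ)) (hδ : kuriharaNumber D.f (3 ^ k) ℓ ψ ≠ 0)
    {q : ℚ} (hq : shaAn W = (q : ℂ)) : BSDp W 3 ↔ padicValRat 3 q = 0 :=
  RankOne.bsdp_iff_padicValRat_eq_zero_of_kim2025_OPEN_of_casselsTate_of_kuriharaNumber_ne_zero W 3 hK25s
    hCT hGZK hmod le_rfl hr (ClassX8.towerSurj_of_semistable W 3 hmod' hLL hX hsst) D hk hk2 ℓ hℓ hcyc ψ hψ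
    hδ hq

/-- **O4@3 = X7@3 ∧ `r_an = 1`, tower from surj(3) + ONE Frobenius mod `9`: `BSD(E,3) ⟺ ord₃ #Ш_an = 0`
from ONE Kurihara number of level `k ≤ 2`** (on O4@3's 1 407 surj cells — 97 Tam-free, 65 of them with
`ord₃ #Ш_an = 0`), CONDITIONAL on `hK25s` (OPEN); X7 joint pair, B side. Per pair; NOT a class theorem.
[claim: Kim2025RefinedTNC, status: under-review] [cite: Kim2025RefinedTNC, Thm. 1.1 (ANNOUNCED, OPEN binder)]
[cite: SilvermanAEC2009, Thm. X.4.14] [cite: SerreAbelianLadic1968, Ch. IV §3.4, Lemma 3 (IV-23)]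
[cite: Miller2011LMS, Def. 1.1] -/
theorem X7RankOne.bsdp_iff_padicValRat_eq_zero_of_kim2025_OPEN_of_kuriharaNumber_ne_zero_of_frobenius
    (hK25s : Kim2025.thm11_kimShaLength_of_integralPeriod_OPEN)
    (hCT : exists_casselsTate_pairing (K := ℚ))
    (hGZK : rank_eq_analyticRank_of_analyticRank_le_one) (hmod : hasEntireLFunction_rat)
    (hr : W.analyticRank = 1) (hX : ClassX7 W 3) (hs : Surj W 3)
    (ℓ' : ℕ) [Fact ℓ'.Prime] (hgood : W.HasGoodReductionAtPrime ℓ')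
    (hℓ9 : ℓ' % 9 = 2 ∨ ℓ' % 9 = 5) (ha9 : W.frobeniusTrace ℓ' % 9 = 3 ∨ W.frobeniusTrace ℓ' % 9 = 6)
    {N : ℕ} [NeZero N] (D : ModularParametrizationData W N)
    {k : ℕ} (hk : 1 ≤ k) (hk2 : k ≤ 2) (ℓ : ℕ) [Fact ℓ.Prime] (hℓ : Kato.IsKolyvaginPrime W 3 k ℓ)
    (hcyc : Nat.card {P : ((WeierstrassCurve.integralModelInt W).map
        (Int.castRingHom (ZMod ℓ))).toAffine.Point // 3 • P = 0} ≤ 3)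
    (ψ : (ℓ'' : ℕ) → (ZMod ℓ'')ˣ →* Multiplicative (ZMod (3 ^ k)))
    (hψ : Function.Surjective (ψ ℓ)) (hδ : kuriharaNumber D.f (3 ^ k) ℓ ψ ≠ 0)
    {q : ℚ} (hq : shaAn W = (q : ℂ)) : BSDp W 3 ↔ padicValRat 3 q = 0 := by
  have _ := hX.1
  exact RankOne.bsdp_iff_padicValRat_eq_zero_of_kim2025_OPEN_of_casselsTate_of_kuriharaNumber_ne_zero W 3
    hK25s hCT hGZK hmod le_rfl hr (towerSurj_of_frobenius_of_eq_three W 3 rfl hs ℓ' hgood hℓ9 ha9) D hk hk2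
    ℓ hℓ hcyc ψ hψ hδ hq

end Summit.BirchSwinnertonDyer.Rank1Residual.Supersingular

end
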